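import Literature.Probability.RandomPlanarGeometry.HexSAWBrickWallSlabFugacity
import Mathlib.Analysis.SpecialFunctions.Pow.Continuity
import HarnessLib

/-!
# The armchair-slab rates grow at most like `√y`: `μ_H(y') ≤ √(y'/y) · μ_H(y)` for every slab width `H ≥ 1` and `0 < y ≤ y'`

Topic `Literature/Probability/RandomPlanarGeometry` (continues `HexSAWBrickWallSlabFugacity.lean` — Beaton's strips of the rotated
honeycomb lattice as the column slabs `Slab_H` of the brick wall, with a fugacity `y` per vertex in the boundary COLUMN `x₀ = 0`:
`HexBW.leftVisits`, `Ĉ_{H,n}(y,1) = HexBW.slabZ H n y`, `μ_H(y) = HexBW.slabMuY H y`, `tendsto_slabZ_rpow`).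

Source of the frame.  N. R. Beaton, *The critical surface fugacity of self-avoiding walks on a rotated honeycomb lattice*, J. Phys. A 47
(2014) 075003, arXiv:1210.0274v3, §3.2, Proposition 8 (p. 15: "`μ_T(y,z)` is finite and non-decreasing in `y` and `z` … log-convex")
and §3.1 (p. 14: "the lower bound `μ(y) ≥ √y` is obtained by considering walks which step along the surface").  What is added here is
the matching UPPER growth for the slabs.  The boundary column is an ARMCHAIR line (its vertices come in dimers `{(0,2k),(0,2k+1)}`), and
the key parity fact is **`not_wall_add_two`: a brick-wall walk that is on the wall at time `i` is OFF the wall at time `i + 2`**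
(whenever `w (i+2) ≠ w i`) (after a dimer step the only exit is horizontal and cannot come back in one step; after a horizontal exit the
only wall neighbour of `(1, Y)` is the vertex just left).  Hence at most two wall visits in any four consecutive times,
`leftVisits ≤ n/2 + 2` (`leftVisits_le_div_two_add_two`), each summand of `Ĉ_{H,n}(y,1)` grows at most like `y^{n/2+2}`, and
**`μ_H(y') ≤ √(y'/y) · μ_H(y)`** (`slabMuY_le_sqrt_mul`): `μ_H(y)/√y` is non-increasing in `y` for every `H ≥ 1`.  (The lane's
`HexSAWArmchairSqrtAsymptotic.lean` has the weaker "no three consecutive wall vertices"; the two-step exclusion is the sharp form.)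
Label (lane «pcv-sawmu»): an elementary COROLLARY of the printed objects' parity structure, not found stated in print (NEW-IN-WRITING,
modest at most); slab companion of the lane's half-plane statements for `β(y)` / `β_rot(y)`.

## Contents (namespace `Literature.Probability.RandomPlanarGeometry.SAW.HexBW`, all PROVED)

* **`not_wall_add_two`** — on the wall at time `i` ⇒ off the wall at time `i+2` (any two consecutive bonds with `w (i+2) ≠ w i`);
* `leftVisits_le_div_two_add_two` — `leftVisits a υ n ≤ n / 2 + 2` on `S_n(Slab_H)`;
* `slabZ_le_pow_mul` — `Ĉ_{H,n}(y',1) ≤ (y'/y)^{n/2+2} · Ĉ_{H,n}(y,1)` for `0 < y ≤ y'`;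
* **`slabMuY_le_sqrt_mul`** — `1 ≤ H → 0 < y ≤ y' → μ_H(y') ≤ √(y'/y) · μ_H(y)`; `antitoneOn_slabMuY_div_sqrt`;
* `slabMuY_le_sqrt_mul_one` — `1 ≤ H → 1 ≤ y → μ_H(y) ≤ √y · μ_H(1)` (uniform in the slab once `μ_H(1) = μ(Slab_H) ≤ μ_ℍ` is invoked).
-/

noncomputable section

open Filter Topology Finset Literature.Probability.LatticeModels Literature.Probability.Percolation SimpleGraph

namespace Literature.Probability.RandomPlanarGeometry.SAW.HexBW

variable {y : ℝ}

/-! ### The two-step exclusion at an armchair wall -/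

/-- **On the wall at time `i` ⇒ off the wall at time `i + 2`**, for any two consecutive brick-wall bonds `w i — w (i+1) — w (i+2)`
with `w (i+2) ≠ w i` (no half-plane hypothesis is needed: the only wall neighbour of `(±1, Y)` is `(0, Y)`, and two consecutive vertical
bonds in the column `x₀ = 0` do not exist). [cite: EntingJensen2009, §7.4.2, Fig. 7.10 (brickwork form of the honeycomb lattice); Beaton2014RotatedHoneycomb, §3.1 (arXiv v3 p. 14: walks which step along the surface)] -/
theorem not_wall_add_two {w : ℕ → Site 2} {i : ℕ} (h1 : brickWallGraph.Adj (w i) (w (i + 1)))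
    (h2 : brickWallGraph.Adj (w (i + 1)) (w (i + 2))) (hne : w i ≠ w (i + 2)) (h0 : w i 0 = 0) :
    w (i + 2) 0 ≠ 0 := by
  intro h
  have hne' : w i 1 ≠ w (i + 2) 1 := fun e => hne ((site_two_eq_iff _ _).2 ⟨by rw [h0, h], e⟩)
  rw [brickWallGraph_adj_coord] at h1 h2
  omega

/-- **`leftVisits a υ n ≤ n/2 + 2`** on `S_n(Slab_H)`: at most two boundary-column visits in any four consecutive times.
[cite: Beaton2014RotatedHoneycomb, §3.2, Proposition 8 (arXiv:1210.0274v3 p. 15) and §3.1 (p. 14: the surface zig-zag realises the extreme)] -/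
theorem leftVisits_le_div_two_add_two {H n : ℕ} {p : Site 2 × (ℕ → Site 2)} (hp : p ∈ slabPairs H n) :
    leftVisits p.1 p.2 n ≤ n / 2 + 2 := by
  obtain ⟨-, hυ, hbw, -⟩ := mem_slabPairs.1 hp
  obtain ⟨-, -, -, hinj⟩ := Zd.mem_saws.1 hυ
  set w : ℕ → Site 2 := fun i => p.1 + p.2 i with hw
  set P : ℕ → Prop := fun m => (p.1 + p.2 m) 0 = 0 with hP
  -- the two-step exclusion along the walk
  have key : ∀ m, m + 2 ≤ n → P m → ¬ P (m + 2) := by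
    intro m hm hPm hP2
    have hne : w m ≠ w (m + 2) := fun e => by
      have e' : p.2 m = p.2 (m + 2) := add_left_cancel e
      have := hinj (show m ∈ {i | i ≤ n} by simp only [Set.mem_setOf_eq]; omega)
        (show m + 2 ∈ {i | i ≤ n} by simp only [Set.mem_setOf_eq]; omega) e'
      omega
    exact not_wall_add_two (hbw m (by omega)) (by simpa only [hw, show m + 1 + 1 = m + 2 by omega] using hbw (m + 1) (by omega))
      hne hPm hP2
  -- partial sums: `S (k+4) ≤ S k + 2`
  set S : ℕ → ℕ := fun k => ∑ m ∈ Finset.range k, if P m then 1 else 0 with hS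
  have hpair : ∀ m, m + 2 ≤ n → (if P m then 1 else 0) + (if P (m + 2) then 1 else 0) ≤ 1 := by
    intro m hm
    by_cases h1 : P m
    · have h2 := key m hm h1; simp [h1, h2]
    · by_cases h2 : P (m + 2) <;> simp [h1, h2]
  have hone : ∀ m, (if P m then 1 else 0) ≤ 1 := fun m => by split_ifs <;> simp
  have hstep : ∀ k, k + 3 ≤ n → S (k + 4) ≤ S k + 2 := by
    intro k hk
    simp only [hS, Finset.sum_range_succ]
    have h1 := hpair k (by omega)
    have h2 := hpair (k + 1) (by omega)
    rw [show k + 1 + 2 = k + 3 by omega] at h2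
    omega
  have main : ∀ k, k ≤ n + 1 → S k ≤ (k + 1) / 2 + 1 := by
    intro k
    induction k using Nat.strong_induction_on with
    | _ k ih =>
      intro hk
      rcases lt_or_ge k 4 with hk4 | hk4
      · -- k ∈ {0,1,2,3}
        interval_cases k
        · simp [hS]
        · simp only [hS, Finset.sum_range_one]; have := hone 0; omega
        · simp only [hS, Finset.sum_range_succ, Finset.sum_range_zero]; have := hone 0; have := hone 1; omega
        · simp only [hS, Finset.sum_range_succ, Finset.sum_range_zero]
          have h02 := hpair 0 (by omega); simp only [Nat.zero_add] at h02; have := hone 1; omega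
      · obtain ⟨j, rfl⟩ : ∃ j, k = j + 4 := ⟨k - 4, by omega⟩
        have h := hstep j (by omega)
        have := ih j (by omega) (by omega)
        omega
  have h := main (n + 1) le_rfl
  unfold leftVisits
  have e : n / 2 + 2 = (n + 1 + 1) / 2 + 1 := by omega
  rw [e]
  exact h

/-! ### The finite-`n` comparison -/

/-- **`Ĉ_{H,n}(y',1) ≤ (y'/y)^{n/2+2} · Ĉ_{H,n}(y,1)` for `0 < y ≤ y'`** (term by term).
[cite: Beaton2014RotatedHoneycomb, §3.2, Proposition 8 (arXiv:1210.0274v3 p. 15: Ĉ_{T,n}(y,z))] -/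
theorem slabZ_le_pow_mul (H n : ℕ) (hy : 0 < y) {y' : ℝ} (hyy' : y ≤ y') :
    slabZ H n y' ≤ (y' / y) ^ (n / 2 + 2) * slabZ H n y := by
  have hq : 1 ≤ y' / y := (one_le_div hy).2 hyy'
  unfold slabZ
  rw [Finset.mul_sum]
  refine Finset.sum_le_sum fun p hp => ?_
  have hb : leftVisits p.1 p.2 n ≤ n / 2 + 2 := leftVisits_le_div_two_add_two hp
  have e : y' ^ leftVisits p.1 p.2 n = (y' / y) ^ leftVisits p.1 p.2 n * y ^ leftVisits p.1 p.2 n := by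
    rw [← mul_pow, div_mul_cancel₀ _ hy.ne']
  rw [e]
  exact mul_le_mul_of_nonneg_right (pow_le_pow_right₀ hq hb) (pow_nonneg hy.le _)

/-! ### The limit -/

/-- The prefactor: `q^{1/2 + 2/n} → √q`. [cite: MadrasSlade1993, §1.2 (Fekete's lemma: n-th roots)] -/
theorem tendsto_rpow_half_add_two_div {q : ℝ} (hq : 0 < q) :
    Tendsto (fun n : ℕ => q ^ (1 / 2 + 2 / (n : ℝ))) atTop (𝓝 (Real.sqrt q)) := by
  have h1 : Tendsto (fun n : ℕ => (1 : ℝ) / 2 + 2 / (n : ℝ)) atTop (𝓝 (1 / 2)) := by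
    have := tendsto_const_div_atTop_nhds_zero_nat (2 : ℝ)
    simpa using this.const_add (1 / 2 : ℝ)
  have h2 := (Real.continuousAt_const_rpow hq.ne').tendsto.comp h1
  rw [Real.sqrt_eq_rpow]
  exact h2

/-- **`μ_H(y') ≤ √(y'/y) · μ_H(y)` for every slab `H ≥ 1` and `0 < y ≤ y'`**: the slab rate grows at most like `√y`.
[cite: Beaton2014RotatedHoneycomb, §3.2, Proposition 8 (arXiv:1210.0274v3 p. 15) and §3.1 (p. 14: μ(y) ≥ √y from the surface zig-zag)] -/
theorem slabMuY_le_sqrt_mul {H : ℕ} (hH : 1 ≤ H) (hy : 0 < y) {y' : ℝ} (hyy' : y ≤ y') :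
    slabMuY H y' ≤ Real.sqrt (y' / y) * slabMuY H y := by
  have hy' : 0 < y' := lt_of_lt_of_le hy hyy'
  set q := y' / y with hqdef
  have hq1 : 1 ≤ q := (one_le_div hy).2 hyy'
  have hq0 : 0 < q := lt_of_lt_of_le one_pos hq1
  have hL := tendsto_slabZ_rpow hH hy'
  have hR : Tendsto (fun n : ℕ => q ^ (1 / 2 + 2 / (n : ℝ)) * (slabZ H n y) ^ (1 / (n : ℝ))) atTop
      (𝓝 (Real.sqrt q * slabMuY H y)) := (tendsto_rpow_half_add_two_div hq0).mul (tendsto_slabZ_rpow hH hy)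
  refine le_of_tendsto_of_tendsto hL hR ?_
  filter_upwards [Filter.eventually_ge_atTop 1] with n hn
  have hZ := slabZ_le_pow_mul H n hy hyy'
  have hZ0 : 0 ≤ slabZ H n y' := (slabZ_pos hH n hy').le
  have h1 : slabZ H n y' ^ (1 / (n : ℝ)) ≤ ((q ^ (n / 2 + 2) * slabZ H n y)) ^ (1 / (n : ℝ)) :=
    Real.rpow_le_rpow hZ0 hZ (by positivity)
  have h2 : (q ^ (n / 2 + 2) * slabZ H n y) ^ (1 / (n : ℝ)) =
      (q ^ (n / 2 + 2)) ^ (1 / (n : ℝ)) * (slabZ H n y) ^ (1 / (n : ℝ)) :=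
    Real.mul_rpow (pow_nonneg hq0.le _) (slabZ_pos hH n hy).le
  have h3 : (q ^ (n / 2 + 2)) ^ (1 / (n : ℝ)) ≤ q ^ (1 / 2 + 2 / (n : ℝ)) := by
    rw [← Real.rpow_natCast q (n / 2 + 2), ← Real.rpow_mul hq0.le]
    refine Real.rpow_le_rpow_of_exponent_le hq1 ?_
    have hd : (((n / 2 + 2 : ℕ)) : ℝ) ≤ (n : ℝ) / 2 + 2 := by
      have : ((n / 2 : ℕ) : ℝ) ≤ (n : ℝ) / 2 := by
        rw [le_div_iff₀ (by norm_num : (0:ℝ) < 2)]; exact_mod_cast Nat.div_mul_le_self n 2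
      push_cast; linarith
    have hn0 : (0 : ℝ) < n := by exact_mod_cast hn
    calc (((n / 2 + 2 : ℕ)) : ℝ) * (1 / (n : ℝ)) ≤ ((n : ℝ) / 2 + 2) * (1 / (n : ℝ)) :=
          mul_le_mul_of_nonneg_right hd (by positivity)
      _ = 1 / 2 + 2 / (n : ℝ) := by field_simp
  calc slabZ H n y' ^ (1 / (n : ℝ)) ≤ (q ^ (n / 2 + 2)) ^ (1 / (n : ℝ)) * (slabZ H n y) ^ (1 / (n : ℝ)) := h2 ▸ h1
    _ ≤ q ^ (1 / 2 + 2 / (n : ℝ)) * (slabZ H n y) ^ (1 / (n : ℝ)) :=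
        mul_le_mul_of_nonneg_right h3 (Real.rpow_nonneg (slabZ_pos hH n hy).le _)

/-- **`μ_H(y)/√y` is non-increasing on `(0, ∞)`** for every slab `H ≥ 1`.
[cite: Beaton2014RotatedHoneycomb, §3.2, Proposition 8 (arXiv:1210.0274v3 p. 15)] -/
theorem antitoneOn_slabMuY_div_sqrt {H : ℕ} (hH : 1 ≤ H) : AntitoneOn (fun y : ℝ => slabMuY H y / Real.sqrt y) (Set.Ioi 0) := by
  intro y hy y' _ hyy'
  have hy0 : (0:ℝ) < y := hy
  have hy' : 0 < y' := lt_of_lt_of_le hy0 hyy'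
  have h := slabMuY_le_sqrt_mul hH hy0 hyy'
  have hsy' : 0 < Real.sqrt y' := Real.sqrt_pos.2 hy'
  rw [Real.sqrt_div hy'.le] at h
  show slabMuY H y' / Real.sqrt y' ≤ slabMuY H y / Real.sqrt y
  rw [div_le_iff₀ hsy']
  calc slabMuY H y' ≤ Real.sqrt y' / Real.sqrt y * slabMuY H y := h
    _ = slabMuY H y / Real.sqrt y * Real.sqrt y' := by ring

/-- `μ_H(y) ≤ √y · μ_H(1)` for `y ≥ 1` and every slab `H ≥ 1` — the sharp form (exponent `1/2`) of the lane's `μ_H(y) ≤ y · μ(Slab_H)`.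
[cite: Beaton2014RotatedHoneycomb, §3.2, Proposition 8 (arXiv:1210.0274v3 p. 15)] -/
theorem slabMuY_le_sqrt_mul_one {H : ℕ} (hH : 1 ≤ H) (hy : 1 ≤ y) : slabMuY H y ≤ Real.sqrt y * slabMuY H 1 := by
  have h := slabMuY_le_sqrt_mul hH one_pos hy
  rwa [div_one] at h

end Literature.Probability.RandomPlanarGeometry.SAW.HexBW
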